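import Mathlib
import HarnessLib.Audit
import Summits.PneNP.PneNP.Theorems.PstarGateU2BranchB
import Summits.PneNP.PneNP.Theorems.PstarGateU2Coupling
import Summits.PneNP.PneNP.Theorems.PstarGateCaseTLocal
import Summits.PneNP.PneNP.Theorems.PstarGateHyperplane

/-!
# One GATED chord, node N5: every edge of one cycle off `u` TOUCHES the other cycle (E2; prover-1 g19)

FRONTIER range-avoidance ladder, rung F-N3 (`stmt-PneNP-19007`), cell `pnp-ideate` (`PstarGateNodesX.GateU2X`); restricted-model proof complexity —
nothing here bears on `P` versus `NP`.

`N = {e, e'}`, `e` gated, `e'` doubly read; gate chamber `H₁ = {x_u = κ₀ + 1}`.  A four-point argument: if the zeros of `f` on the chamber force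
`g = 1` (separation, `PstarGateU2Coupling.u2_sep`, in either direction), and some edge `π = (a, b)` of `f`'s fundamental set has both AND variables
off `u` and off the AND variables of `g`'s fundamental set, then at a chamber zero `z` of `g` (`PstarGateU2BranchB.exists_off_on_chamber`) the
four points `z, z + e_a, z + e_b, z + e_a + e_b` keep `g = 0`, while `f` has second difference `B_f(e_a, e_b) = 1` there — so `f` vanishes at one
of them: a common chamber zero, contradiction.

* `touch_core` — the four-point lemma;
* `u2_touch` / `u2_touch'` — **every edge of `D e` (resp. `D e'`) avoiding `u` has an AND variable among those of `D e'` (resp. `D e`).**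
-/

set_option linter.dupNamespace false -- `Summit.PneNP.PneNP.…`: summit = sub-problem name (D-0017 single-conjunct layout)

open Finset Literature.Computability.Complexity
open Summit.PneNP.PneNP.Theorems.PstarTyped (Typed)
open Summit.PneNP.PneNP.Theorems.PstarSALevel (SimpleOverlap)
open Summit.PneNP.PneNP.Theorems.PstarGapLinearised (andPair)
open Summit.PneNP.PneNP.Theorems.PstarProductRank (qform polar)
open Summit.PneNP.PneNP.Theorems.PstarPathRank (polar_basis polar_symm_and)
open Summit.PneNP.PneNP.Theorems.PstarReadSumset (V2)
open Summit.PneNP.PneNP.Theorems.PstarChordSystem (ChordSystem)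
open Summit.PneNP.PneNP.Theorems.PstarChordBridgeTools (privs coef)
open Summit.PneNP.PneNP.Theorems.PstarChordBridge (BridgeData sys Solution Lift)
open Summit.PneNP.PneNP.Theorems.PstarChordBridgeForcing (gam sys_u_eq)
open Summit.PneNP.PneNP.Theorems.PstarChordBridgeCorner (andAdj_iff_mem)
open Summit.PneNP.PneNP.Theorems.PstarGateBridge (GateHyp)
open Summit.PneNP.PneNP.Theorems.PstarGateHyperplane (qform_single_and)
open Summit.PneNP.PneNP.Theorems.PstarGateCaseTLocal (u_add)
open Summit.PneNP.PneNP.Theorems.PstarGateNodes (GateData)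
open Summit.PneNP.PneNP.Theorems.PstarGateNodesX (GateDataX)
open Summit.PneNP.PneNP.Theorems.PstarGateU2Joins (polar_single_off)
open Summit.PneNP.PneNP.Theorems.PstarGateU2Coupling (u2_sep)
open Summit.PneNP.PneNP.Theorems.PstarGateU2BranchB (exists_off_on_chamber)

namespace Summit.PneNP.PneNP.Theorems.PstarGateU2Touch

variable {n m : ℕ}

/-- **The four-point lemma.**  Chords `c, c'` of well-formed bridge data; on the chamber `{x_u = κ}` the zeros of `u_c` force `u_{c'} = 1`; an edge
`π ∈ D c` with both AND variables off `u` and off the AND variables of `D c'`: contradiction. -/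
theorem touch_core (I : LocalMap 4 n m) (hI : I.IsPure xorAndPred) (hS : SimpleOverlap I) {B : BridgeData n m} (hW : B.WF I)
    {c c' : Fin m} (hc' : c' ∈ B.N) (u : Fin n) (κ : ZMod 2)
    (hforce : ∀ x : Fin n → ZMod 2, x u = κ → (sys I B).u c x = 0 → (sys I B).u c' x = 1)
    {π : Fin m} (hπ : π ∈ B.D c) (h2u : I.vars π 2 ≠ u) (h3u : I.vars π 3 ≠ u)
    (h2 : I.vars π 2 ∉ (B.D c').biUnion (andPair I)) (h3 : I.vars π 3 ∉ (B.D c').biUnion (andPair I)) : False := by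
  classical
  obtain ⟨z, hzu, hz0⟩ := exists_off_on_chamber I hI hS hW hc' u κ
  set ea : Fin n → ZMod 2 := Pi.single (I.vars π 2) 1 with hea
  set eb : Fin n → ZMod 2 := Pi.single (I.vars π 3) 1 with heb
  have heau : ea u = 0 := by rw [hea, Pi.single_eq_of_ne (Ne.symm h2u)]
  have hebu : eb u = 0 := by rw [heb, Pi.single_eq_of_ne (Ne.symm h3u)]
  -- `u_{c'}` is invariant under the shifts `e_a`, `e_b`
  have hinv : ∀ (x v : Fin n → ZMod 2), (v = ea ∨ v = eb) → (sys I B).u c' (x + v) = (sys I B).u c' x := by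
    intro x v hv
    rw [u_add]
    have hQv : (sys I B).u c' v = (sys I B).u c' 0 := by
      rw [sys_u_eq, sys_u_eq]
      rcases hv with rfl | rfl
      · rw [hea, qform_single_and I hI]; unfold qform; simp
      · rw [heb, qform_single_and I hI]; unfold qform; simp
    have hpol : polar (B.D c') (fun j => I.vars j 2) (fun j => I.vars j 3) x v = 0 := by
      rw [polar_symm_and I (B.D c') x v]
      rcases hv with rfl | rfl
      · exact polar_single_off I (B.D c') h2 x
      · exact polar_single_off I (B.D c') h3 x
    rw [hQv, hpol, add_zero, add_assoc, CharTwo.add_self_eq_zero, add_zero]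
  have hg1 : (sys I B).u c' (z + ea) = 0 := by rw [hinv z ea (Or.inl rfl), hz0]
  have hg2 : (sys I B).u c' (z + eb) = 0 := by rw [hinv z eb (Or.inr rfl), hz0]
  have hg3 : (sys I B).u c' (z + ea + eb) = 0 := by rw [hinv _ eb (Or.inr rfl), hinv z ea (Or.inl rfl), hz0]
  -- so `u_c = 1` at all four points
  have hone : ∀ x : Fin n → ZMod 2, x u = κ → (sys I B).u c' x = 0 → (sys I B).u c x = 1 := by
    intro x hx hg
    by_contra hf
    have z01 : ∀ t : ZMod 2, t ≠ 1 → t = 0 := by decide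
    have h := hforce x hx (z01 _ hf)
    rw [hg] at h
    exact zero_ne_one h
  have f0 := hone z hzu hz0
  have f1 := hone (z + ea) (by rw [Pi.add_apply, hzu, heau, add_zero]) hg1
  have f2 := hone (z + eb) (by rw [Pi.add_apply, hzu, hebu, add_zero]) hg2
  have f3 := hone (z + ea + eb) (by rw [Pi.add_apply, Pi.add_apply, hzu, heau, hebu, add_zero, add_zero]) hg3
  -- but the second difference of `u_c` along `e_a, e_b` is `B(e_a, e_b) = 1`
  have hab : polar (B.D c) (fun j => I.vars j 2) (fun j => I.vars j 3) ea eb = 1 := by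
    rw [hea, heb, polar_basis I hI hS, if_pos ((andAdj_iff_mem I hI hS (B.D c) π).2 hπ)]
  have k2 := u_add I B c z eb
  have k3 := u_add I B c (z + ea) eb
  rw [map_add, LinearMap.add_apply, hab] at k3
  have h10 : (1 : ZMod 2) = 0 := by linear_combination k2 - k3 + f3 - f1 - f2 + f0
  exact one_ne_zero h10

/-- **Every edge of `D e` off `u` touches `D e'`.** -/
theorem u2_touch (I : LocalMap 4 n m) (hI : I.IsPure xorAndPred) (hT : Typed I) (hS : SimpleOverlap I) {r₀ : ℕ} {B : BridgeData n m}
    {e g₀ : Fin m} {u : Fin n} {κ₀ : ZMod 2} (hD : GateDataX I r₀ B e g₀ u κ₀) {e' : Fin m} (hN : B.N = {e, e'}) (hne : e' ≠ e)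
    (hU2 : ∀ a, (sys I B).ρ e' a ≠ 0 ∧ (sys I B).ρ' e' a ≠ 0 ∧ (sys I B).ρ e' a ≠ (sys I B).ρ' e' a)
    {π : Fin m} (hπ : π ∈ B.D e) (h2u : I.vars π 2 ≠ u) (h3u : I.vars π 3 ≠ u)
    (h2 : I.vars π 2 ∉ (B.D e').biUnion (andPair I)) (h3 : I.vars π 3 ∉ (B.D e').biUnion (andPair I)) : False := by
  obtain ⟨-, hW, -⟩ := id hD
  have he' : e' ∈ B.N := by rw [hN]; exact mem_insert_of_mem (mem_singleton_self _)
  have hsep := u2_sep I hI hT hD hN hne hU2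
  refine touch_core I hI hS hW he' u (κ₀ + 1) (fun x hx h0 => ?_) hπ h2u h3u h2 h3
  have z01 : ∀ t : ZMod 2, t ≠ 0 → t = 1 := by decide
  exact z01 _ (hsep x hx h0)

/-- **Every edge of `D e'` off `u` touches `D e`.** -/
theorem u2_touch' (I : LocalMap 4 n m) (hI : I.IsPure xorAndPred) (hT : Typed I) (hS : SimpleOverlap I) {r₀ : ℕ} {B : BridgeData n m}
    {e g₀ : Fin m} {u : Fin n} {κ₀ : ZMod 2} (hD : GateDataX I r₀ B e g₀ u κ₀) {e' : Fin m} (hN : B.N = {e, e'}) (hne : e' ≠ e)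
    (hU2 : ∀ a, (sys I B).ρ e' a ≠ 0 ∧ (sys I B).ρ' e' a ≠ 0 ∧ (sys I B).ρ e' a ≠ (sys I B).ρ' e' a)
    {π : Fin m} (hπ : π ∈ B.D e') (h2u : I.vars π 2 ≠ u) (h3u : I.vars π 3 ≠ u)
    (h2 : I.vars π 2 ∉ (B.D e).biUnion (andPair I)) (h3 : I.vars π 3 ∉ (B.D e).biUnion (andPair I)) : False := by
  obtain ⟨-, hW, -, -, -, -, -, -, hG, -⟩ := id hD
  have he : e ∈ B.N := hG.1
  have hsep := u2_sep I hI hT hD hN hne hU2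
  refine touch_core I hI hS hW he u (κ₀ + 1) (fun x hx h0 => ?_) hπ h2u h3u h2 h3
  by_contra h1
  have z01 : ∀ t : ZMod 2, t ≠ 1 → t = 0 := by decide
  exact hsep x hx (z01 _ h1) h0

end Summit.PneNP.PneNP.Theorems.PstarGateU2Touch
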